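/-
Origin: expansion seat `planner-pub-hodgecm-mc-axioms-1-g14-0`, handover #W225 2026-08-20T15:53:55Z md5 caa7214abc26 (PKG 8108e9eb4ede → caa7214abc26; 105 l.; MECHANICAL (iib-R) rewrite v3.1 of the PKG file as it stands (4 token edits; rules R1x1+RX[h₂]x3)) (`HOME/mc/pub-hodgecm-mc-axioms-1-g14/revendor/kit-r55/stage55/HodgeCM/Model/Binders/Gen12PinsROG.lean`, md5 caa7214abc26, 105 lines);
landed by the gen-22 packager (p-g22) in gate run 55 REPLACES the earlier landed copy of `HodgeCM/Model/Binders/Gen12PinsROG.lean` (seat copy carried the packager Origin header of an earlier run (stripped)).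
-/
/-
Origin: speedrun cell pub-hodgecm, MODEL-CONSTRUCTION sub-cell, unit pub-hodgecm-mc-binder-1-g10 (BINDER PROVER, gen 10; S RE-PIN P3 of K34-PLAN §3: row 16 at
`S := SInstance.SROG`), seat prover-pub-hodgecm-mc-binder-1-g10-0, 2026-08-20.  Target in PKG: HodgeCM/Model/Binders/Gen12PinsROG.lean (NEW additive leaf;
imports `Binders/Gen12PinsTotalP` (this kit) + the RUN-42-installed sinst-1 `Model/ThetaAdelicSideReadOff` + `Model/ArchLineInputOf`).  KERNEL ONLY:
2 theorems; 0 records, nothing cited, 0 `def … : Prop`, MODEL-N ±0, E unchanged.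
-/
import Summits.HodgeConjecture.HodgeCM.Model.Binders.Gen12PinsTotalP_2
import Summits.HodgeConjecture.HodgeCM.Model.ThetaAdelicSideReadOff
import Summits.HodgeConjecture.HodgeCM.Model.ArchLineInputOf

/-!
# Row 16 (`gen12`) ON THE GUARD at the S pin of glue-1's #395/#396: `S := SInstance.SROG …`

`SROG @hGR @χV @hGR₀..₃ @μ hΔ₁ hΔ₂ hΔ₃ = SGP @GOG @hG_GOG @hGR @η' @hη' @hηc' @hGR₀..₃ @(AR …)` with `η' := EtaChi.η @χV (χWR @hGR @hGR₀ @hGR₁ @μ)`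
(sinst-1-g3, RUN 42), so #P26 `Gen12PinsP.gen12_totalAt` at `G := GOG`, `AG := AR` gives, PER CONTEXT under `hg : GOG V c`:
`Nonempty (….Gen12FunBridge V c)` for the model at `W := Gen12Pins.Wg @hGR @η' @hη' @hηc' @τSyl @TSyl @hTSyl` (= `HypCensus.Wcm hGR η' hη' hηc'`
by `rfl`, #32) and `S := SROG …`; the (N1)₀,₁ weights of `AR` are `archLineInputOf_w` (`rfl`).  NOTE FOR THE E CHILD: the W pin MUST carry the
S pin's character `η'` (the seesaw identity `op_total` couples `W.ρ` and the line representations through ONE `η`); a child pinning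
`W := Wcm hGR η hη hηc` with a free `η` cannot be met by rows 16/17.  The bit `h` is a free variable here (instantiate `h := orientBitι L ι₁`
pointwise); off the guard (`¬ GOG V c`) the side is sanity-1's degenerate one and the row is a sanity leaf.
-/

set_option autoImplicit false

noncomputable section

open MeasureTheory NumberField

namespace HodgeCM.Model

open HodgeCM HodgeCM.Universe HodgeCM.Adelic
open Literature.NumberTheory.Weil1964
open Literature.NumberTheory.Automorphic (piSchwartzBruhat archWeight)
open Literature.NumberTheory.GelbartRogawski1991.UnitaryDualPair
open Literature.AlgebraicGeometry.HodgeTheory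
open Literature.NumberTheory.Automorphic.PicardCM
open Literature.NumberTheory.Transcendental (Arapura2012_Cor_15_4_6)
open HodgeCM.Model.ThetaSpace
open HodgeCM.Model.ArchSideTerm

namespace Gen12PinsP

variable
  (hGR : ∀ {L : CMField} {ι₁ : L →+* ℂ} (V : HermSpace3 L ι₁) (c : SeesawCtx L),
    (cmSplittingDatum (L : Type) finProdFinEquiv (frameD V) (frameD_real V) (frameD_ne V) (dW c.D) (dW_real c.D)
      (dW_ne c.D)).CompatibleSplitting)
  (χV : ∀ {L : CMField} {ι₁ : L →+* ℂ} (_V : HermSpace3 L ι₁) (_c : SeesawCtx L),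
    ContinuousMonoidHom (relNormOneIdeles (↥(NumberField.maximalRealSubfield (L : Type))) (L : Type) ⧸
      relNormOneRat (↥(NumberField.maximalRealSubfield (L : Type))) (L : Type)) Circle)
  (hGR₀ : ∀ {L : CMField} {ι₁ : L →+* ℂ} (V : HermSpace3 L ι₁) (c : SeesawCtx L),
    (cmSplittingDatum (L : Type) (e₁) (frameD V) (frameD_real V) (frameD_ne V) (lineVec (L : Type) (dW c.D 0))
      (fun _ => dW_real c.D 0) (fun _ => dW_ne c.D 0)).CompatibleSplitting)
  (hGR₁ : ∀ {L : CMField} {ι₁ : L →+* ℂ} (V : HermSpace3 L ι₁) (c : SeesawCtx L),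
    (cmSplittingDatum (L : Type) (e₁) (frameD V) (frameD_real V) (frameD_ne V) (lineVec (L : Type) (dW c.D 1))
      (fun _ => dW_real c.D 1) (fun _ => dW_ne c.D 1)).CompatibleSplitting)
  (hGR₂ : ∀ {L : CMField} {ι₁ : L →+* ℂ} (V : HermSpace3 L ι₁) (c : SeesawCtx L),
    (cmSplittingDatum (L : Type) (e₁) (frameD V) (frameD_real V) (frameD_ne V) (lineVec (L : Type) (dW' c.D 0))
      (fun _ => dW'_real c.D 0) (fun _ => dW'_ne c.D 0)).CompatibleSplitting)
  (hGR₃ : ∀ {L : CMField} {ι₁ : L →+* ℂ} (V : HermSpace3 L ι₁) (c : SeesawCtx L),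
    (cmSplittingDatum (L : Type) (e₁) (frameD V) (frameD_real V) (frameD_ne V) (lineVec (L : Type) (dW' c.D 1))
      (fun _ => dW'_real c.D 1) (fun _ => dW'_ne c.D 1)).CompatibleSplitting)
  (μ : ∀ {L : CMField}, SeesawCtx L → Fin 4 → NumberField.InfinitePlace (L : Type) → ℤ)
  (hΔ₁ : ∀ {L : CMField} {ι₁ : L →+* ℂ} (V : HermSpace3 L ι₁) (c : SeesawCtx L), ∀ hc : SInstance.GOG V c,
    slotTypeVec V c (hGR V c) (hGR₀ V c) (hGR₁ V c) (hGR₂ V c) (hGR₃ V c) (SInstance.hG_GOG V c hc) 1 -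
      slotTypeVec V c (hGR V c) (hGR₀ V c) (hGR₁ V c) (hGR₂ V c) (hGR₃ V c) (SInstance.hG_GOG V c hc) 0 = μ c 1 - μ c 0)
  (hΔ₂ : ∀ {L : CMField} {ι₁ : L →+* ℂ} (V : HermSpace3 L ι₁) (c : SeesawCtx L), ∀ hc : SInstance.GOG V c,
    slotTypeVec V c (hGR V c) (hGR₀ V c) (hGR₁ V c) (hGR₂ V c) (hGR₃ V c) (SInstance.hG_GOG V c hc) 2 -
      slotTypeVec V c (hGR V c) (hGR₀ V c) (hGR₁ V c) (hGR₂ V c) (hGR₃ V c) (SInstance.hG_GOG V c hc) 0 = μ c 2 - μ c 0)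
  (hΔ₃ : ∀ {L : CMField} {ι₁ : L →+* ℂ} (V : HermSpace3 L ι₁) (c : SeesawCtx L), ∀ hc : SInstance.GOG V c,
    slotTypeVec V c (hGR V c) (hGR₀ V c) (hGR₁ V c) (hGR₂ V c) (hGR₃ V c) (SInstance.hG_GOG V c hc) 3 -
      slotTypeVec V c (hGR V c) (hGR₀ V c) (hGR₁ V c) (hGR₂ V c) (hGR₃ V c) (SInstance.hG_GOG V c hc) 0 = μ c 3 - μ c 0)

variable (hHD : exists_isReal_hodgeModel) (hI : hodgePQ_independent_of_hodgeModel)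
  (h₁ : BallQuotientUniformised)  (h₃ : CMAbelianVarietyRealised)
  (h : Bool) (hA : Arapura2012_Cor_15_4_6)

/-- **Row 16 ON THE GUARD at glue-1's S pin `SROG`** (pointwise; bit `h` free): at a good sextic context with `hg : GOG V c`, E's `Gen12FunBridge V c`
for the model at `W := Wg @hGR @η' @hη' @hηc' @τSyl @TSyl @hTSyl` (`η' := EtaChi.η @χV (χWR …)`, = `HypCensus.Wcm hGR η' hη' hηc'` by `rfl`) and
`S := SInstance.SROG @hGR @χV @hGR₀..₃ @μ hΔ₁ hΔ₂ hΔ₃` is inhabited — NO residual hypothesis. -/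
theorem gen12_ROG_of_GOG {L : CMField} {ι₁ : L →+* ℂ} (V : HermSpace3 L ι₁) (c : SeesawCtx L) (hg : SInstance.GOG V c)
    (hc : (pinT hHD hI h₁ h₃ h hA
      (Gen12Pins.Wg @hGR (@EtaChi.η @χV (@SInstance.χWR @hGR @hGR₀ @hGR₁ @μ)) (@EtaChi.hη @χV (@SInstance.χWR @hGR @hGR₀ @hGR₁ @μ))
        (@EtaChi.hηc @χV (@SInstance.χWR @hGR @hGR₀ @hGR₁ @μ)) @Gen12Pins.τSyl @Gen12Pins.TSyl @Gen12Pins.hTSyl)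
      (SInstance.SROG @hGR @χV @hGR₀ @hGR₁ @hGR₂ @hGR₃ @μ hΔ₁ hΔ₂ hΔ₃) μ).GoodCtx ι₁ c)
    (hK : Module.finrank ℚ c.K = 6) :
    Nonempty ((pinT hHD hI h₁ h₃ h hA
      (Gen12Pins.Wg @hGR (@EtaChi.η @χV (@SInstance.χWR @hGR @hGR₀ @hGR₁ @μ)) (@EtaChi.hη @χV (@SInstance.χWR @hGR @hGR₀ @hGR₁ @μ))
        (@EtaChi.hηc @χV (@SInstance.χWR @hGR @hGR₀ @hGR₁ @μ)) @Gen12Pins.τSyl @Gen12Pins.TSyl @Gen12Pins.hTSyl)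
      (SInstance.SROG @hGR @χV @hGR₀ @hGR₁ @hGR₂ @hGR₃ @μ hΔ₁ hΔ₂ hΔ₃) μ).Gen12FunBridge V c) :=
  gen12_totalAt @SInstance.GOG @SInstance.hG_GOG @hGR (@EtaChi.η @χV (@SInstance.χWR @hGR @hGR₀ @hGR₁ @μ))
    (@EtaChi.hη @χV (@SInstance.χWR @hGR @hGR₀ @hGR₁ @μ)) (@EtaChi.hηc @χV (@SInstance.χWR @hGR @hGR₀ @hGR₁ @μ))
    @hGR₀ @hGR₁ @hGR₂ @hGR₃
    (@SInstance.AR @SInstance.GOG @SInstance.hG_GOG @hGR @χV @hGR₀ @hGR₁ @hGR₂ @hGR₃ @μ @SInstance.hpos_GOG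
      (fun V c hc => hΔ₁ V c hc) (fun V c hc => hΔ₂ V c hc) (fun V c hc => hΔ₃ V c hc))
    hHD hI h₁ h₃ h hA @μ V c hg hc hK (fun k _ => ArchSideTerm.archLineInputOf_w _ k)

end Gen12PinsP

end HodgeCM.Model

end
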